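import Literature.AlgebraicGeometry.Resolution.QuadraticTransformsRegular
import Literature.AlgebraicGeometry.Resolution.RegularCentreRsopPart
import Literature.AlgebraicGeometry.Resolution.SymbolicPowersRsop
import HarnessLib

/-!
# Crux `Steer` (stmt-ResolutionOfSingularities-16345), chain W4.1, R2 σ_top line: **regularity is kept
# along a σ_top-steered run** (piece G `GeoDict`, sub-step G1 of the scoping memo
# `D/res-D-pv-012/G-GeoDict-SCOPING.md`; also what piece X `SteeredExit` re-bases on)

OURS (campaign `res-hironaka`, rung L, slot W4.1, chain W4.1, unit `res-L0-w41-stub-8` carried by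
`res-D-pv-012`; replaces the role of no printed item; NOT a statement of the manuscript under review;
AI-produced, weaker than expert review). Theses-free; no definitions.

* `exists_eq_locAtCentre_of_isLocalBlowupAlong`, `isLocalBlowupAlong_unique` — the local blowing up of
  `R ⊆ O` along an ideal `P` with respect to `O` is `(R[P/x])_{𝔪_O ∩ R[P/x]}` for ANY nonzero `x ∈ P` of
  maximal `O`-value on `P`, hence does not depend on the generating set / chart used to present it
  (Novacoski–Spivakovsky 2014, remark after Lemma 2.10; the tree had this for `P = 𝔪`,
  `IsQuadraticTransformAlong.unique`).
* `isRegularLocalRing_of_isLocalBlowupAlong_of_quotient` — **G1b: if `R` is a regular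
  local ring and `R ⧸ P` is regular (a PERMISSIBLE centre), the local blowing up of `R` along `P` with
  respect to `O` is a regular local ring**: `P` is generated by part `c` of a regular system of parameters
  (Matsumura 14.2, `exists_isRsopPart_span_range_eq`), `c` is quasi-regular (`isQuasiRegular_rsop_comp`),
  so the chart `R[P/c_i]` of the blowing up is a regular ring (`isRegularRing_blowupChart`,
  `isRegularRing_closure_of_isRegularRing_blowupChart`), and the local blowing up is its localisation at
  the centre of `O` for the `c_i` of maximal value (uniqueness above).
* `isRegularLocalRing_of_steeredRunUpTo` — **G1: every member of a σ_top-steered run from a datum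
  regular at the centre of `O` is a regular local ring** (point steps: the tree's
  `IsQuadraticTransformAlong.isRegularLocalRing_of_isRegularLocalRing`; permissible steps: G1b), stated
  generically in the sub-plan's predicate `Perm` exactly as `SteeredRun.steeredRun_dichotomy` (only
  «`Perm S f P → P ≠ ⊤ ∧ IsRegularLocalRing (S ⧸ P)`» is consumed).
[cite: NovacoskiSpivakovsky2014, Def. 2.11] [cite: Abhyankar1959, Lemma 3.20] [cite: Matsumura1987, Thm. 14.2]
-/

set_option linter.dupNamespace false -- layout-mandated `Summit.<S>.<S>.…` (single-conjunct summit)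

open IsLocalRing Literature.AlgebraicGeometry.Resolution

namespace Summit.ResolutionOfSingularities.ResolutionOfSingularities.Theorems.SwitchingDichotomy

namespace SteeredRun

variable {K : Type} [Field K]

/-! ## The chart ring `R[P/x] ⊆ K` and the normal form of a local blowing up along `P` -/

/-- If `u ⊆ P` generates `P` then `R[P/x] = R[u/x]`: for `y = Σ rᵢ uᵢ`, `y/x = Σ rᵢ (uᵢ/x)`.
(The case `P = 𝔪` is the tree's `blowupRing_eq_closure_of_span_eq`.) [folklore] -/
theorem closure_union_image_div_eq_of_span_eq (R : Subring K) (x : K) {P : Ideal R} (u : Set R)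
    (hu : Ideal.span u = P) :
    Subring.closure ((R : Set K) ∪ (fun y : R => (y : K) / x) '' (P : Set R)) =
      Subring.closure ((R : Set K) ∪ (fun y : R => (y : K) / x) '' u) := by
  apply le_antisymm
  · refine Subring.closure_le.mpr ?_
    rintro z (hz | ⟨y, hy, rfl⟩)
    · exact Subring.subset_closure (Or.inl hz)
    · change ((y : R) : K) / x ∈ Subring.closure ((R : Set K) ∪ (fun y : R => (y : K) / x) '' u)
      rw [SetLike.mem_coe, ← hu] at hy
      induction hy using Submodule.span_induction with
      | mem y hy => exact Subring.subset_closure (Or.inr ⟨y, hy, rfl⟩)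
      | zero => simp
      | add y z _ _ hy hz => rw [Subring.coe_add, add_div]; exact Subring.add_mem _ hy hz
      | smul a y _ hy =>
        rw [smul_eq_mul, Subring.coe_mul, mul_div_assoc]
        exact Subring.mul_mem _ (Subring.subset_closure (Or.inl a.2)) hy
  · refine Subring.closure_mono ?_
    rintro z (hz | ⟨y, hy, rfl⟩)
    · exact Or.inl hz
    · exact Or.inr ⟨y, hu ▸ Ideal.subset_span hy, rfl⟩

variable {O : ValuationSubring K} {R R₁ R₂ : Subring K} {P : Ideal R}

/-- **Normal form**: a local blowing up of `R` along `P` with respect to `O` is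
`(R[P/x])_{𝔪_O ∩ R[P/x]}` for some nonzero `x ∈ P` of maximal `O`-value on `P`.
[cite: NovacoskiSpivakovsky2014, Def. 2.11] -/
theorem exists_eq_locAtCentre_of_isLocalBlowupAlong (h : IsLocalBlowupAlong O R P R₁) :
    ∃ x : R, x ∈ P ∧ x ≠ 0 ∧ (∀ y ∈ P, O.valuation (y : K) ≤ O.valuation (x : K)) ∧
      R₁ = locAtCentre (Subring.closure ((R : Set K) ∪ (fun y : R => (y : K) / x) '' (P : Set R))) O := by
  obtain ⟨hRO, u, u₀, hu, hu₀, h0, hval, rfl⟩ := h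
  refine ⟨u₀, hu ▸ Ideal.subset_span (Finset.mem_coe.mpr hu₀), h0, fun y hy => ?_, ?_⟩
  · rw [← hu] at hy
    induction hy using Submodule.span_induction with
    | mem y hy => exact hval y (Finset.mem_coe.mp hy)
    | zero => simp
    | add y z _ _ hy hz =>
      rw [Subring.coe_add]
      exact (Valuation.map_add _ _ _).trans (max_le hy hz)
    | smul a y _ hy =>
      rw [smul_eq_mul, Subring.coe_mul, map_mul]
      calc O.valuation (a : K) * O.valuation (y : K) ≤ 1 * O.valuation (u₀ : K) :=
            mul_le_mul' ((O.valuation_le_one_iff _).mpr (hRO a.2)) hy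
        _ = O.valuation (u₀ : K) := one_mul _
  · rw [closure_union_image_div_eq_of_span_eq R (u₀ : K) (↑u) hu]

/-- **Uniqueness of the local blowing up along `P` with respect to `O`** (it depends only on `P`,
not on the chart: for two elements `x, x'` of maximal value, `x/x'` is a unit of `O`).
[cite: NovacoskiSpivakovsky2014, Lemma 2.10 and Def. 2.11] -/
theorem isLocalBlowupAlong_unique (h₁ : IsLocalBlowupAlong O R P R₁)
    (h₂ : IsLocalBlowupAlong O R P R₂) : R₁ = R₂ := by
  have hRO : R ≤ O.toSubring := h₁.1
  obtain ⟨x₁, hx₁, h0₁, hmax₁, rfl⟩ := exists_eq_locAtCentre_of_isLocalBlowupAlong h₁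
  obtain ⟨x₂, hx₂, h0₂, hmax₂, rfl⟩ := exists_eq_locAtCentre_of_isLocalBlowupAlong h₂
  have h0₁' : ((x₁ : R) : K) ≠ 0 := fun e => h0₁ (Subtype.ext e)
  have h0₂' : ((x₂ : R) : K) ≠ 0 := fun e => h0₂ (Subtype.ext e)
  have hv : O.valuation (x₁ : K) = O.valuation (x₂ : K) :=
    le_antisymm (hmax₂ x₁ hx₁) (hmax₁ x₂ hx₂)
  -- the key inclusion, symmetric in the two charts
  have key : ∀ (a b : R), (a : K) ≠ 0 → (b : K) ≠ 0 → a ∈ P →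
      O.valuation (a : K) = O.valuation (b : K) →
      Subring.closure ((R : Set K) ∪ (fun y : R => (y : K) / a) '' (P : Set R)) ≤
        locAtCentre (Subring.closure ((R : Set K) ∪ (fun y : R => (y : K) / b) '' (P : Set R))) O := by
    intro a b ha hb haP hab
    refine Subring.closure_le.mpr ?_
    rintro z (hz | ⟨y, hy, rfl⟩)
    · exact le_locAtCentre _ O (Subring.subset_closure (Or.inl hz))
    · -- `y/a = (y/b) / (a/b)` with `a/b ∈ R[P/b]` of value `1`
      have hab1 : O.valuation ((a : K) / b) = 1 := by
        rw [map_div₀, hab, div_self ((map_ne_zero _).mpr hb)]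
      refine ⟨(y : K) / b, Subring.subset_closure (Or.inr ⟨y, hy, rfl⟩), (a : K) / b,
        Subring.subset_closure (Or.inr ⟨a, haP, rfl⟩), hab1, ?_⟩
      field_simp
  apply le_antisymm
  · exact (locAtCentre_mono O (key x₁ x₂ h0₁' h0₂' hx₁ hv)).trans (locAtCentre_locAtCentre _ O).le
  · exact (locAtCentre_mono O (key x₂ x₁ h0₂' h0₁' hx₂ hv.symm)).trans (locAtCentre_locAtCentre _ O).le

/-- The local blowing up along `P = (c₁, …, c_r)` presented in the chart of a generator `c i ≠ 0` of
maximal value. [cite: NovacoskiSpivakovsky2014, Def. 2.11] -/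
theorem isLocalBlowupAlong_of_generators (hRO : R ≤ O.toSubring) {r : ℕ} (c : Fin r → R)
    (hcP : Ideal.span (Set.range c) = P) (i : Fin r) (hci : c i ≠ 0)
    (hmax : ∀ j, O.valuation ((c j : R) : K) ≤ O.valuation ((c i : R) : K)) :
    IsLocalBlowupAlong O R P (locAtCentre
      (Subring.closure ((R : Set K) ∪ (fun y : R => (y : K) / (c i : K)) '' Set.range c)) O) := by
  classical
  have hspan : Ideal.span (↑(Finset.univ.image c) : Set R) = P := by
    rw [Finset.coe_image, Finset.coe_univ, Set.image_univ, hcP]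
  refine ⟨hRO, Finset.univ.image c, c i, hspan, Finset.mem_image_of_mem c (Finset.mem_univ i), hci,
    ?_, ?_⟩
  · intro y hy
    obtain ⟨j, -, rfl⟩ := Finset.mem_image.mp hy
    exact hmax j
  · rw [Finset.coe_image, Finset.coe_univ, Set.image_univ]

/-! ## G1b: blowing up a permissible centre keeps regularity -/

/-- **The local blowing up of a regular local ring along a centre with regular quotient is a regular
local ring.** If `R ⊆ K` is a regular local ring, `P ⊆ 𝔪_R` an ideal with `R ⧸ P` regular, and `R₁` the
local blowing up of `R` along `P` with respect to a valuation ring `O ⊇ R`, then `R₁` is a regular local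
ring. [cite: Matsumura1987, Thm. 14.2] [cite: Abhyankar1959, Lemma 3.20] [cite: StacksProject, Tag 0804] -/
theorem isRegularLocalRing_of_isLocalBlowupAlong_of_quotient [IsRegularLocalRing R]
    (hP : P ≤ maximalIdeal R) [IsRegularLocalRing (R ⧸ P)] (h : IsLocalBlowupAlong O R P R₁) :
    IsRegularLocalRing R₁ := by
  classical
  have hRO : R ≤ O.toSubring := h.1
  -- `P` is generated by part `c` of a regular system of parameters
  obtain ⟨r, c, hc, hcP⟩ := exists_isRsopPart_span_range_eq (R := R) hP
  -- `P ≠ ⊥`, so some `c j ≠ 0`; take `c i` of maximal value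
  obtain ⟨x₀, hx₀P, hx₀0, -, -⟩ := exists_eq_locAtCentre_of_isLocalBlowupAlong h
  have hne : ∃ j ∈ (Finset.univ : Finset (Fin r)), ((c j : R) : K) ≠ 0 := by
    by_contra hcon
    have hall : ∀ j, c j = 0 := fun j => by
      by_contra hj
      exact hcon ⟨j, Finset.mem_univ j, fun h0 => hj (Subtype.ext h0)⟩
    have hbot : Ideal.span (Set.range c) = ⊥ := by
      rw [Ideal.span_eq_bot]
      rintro _ ⟨j, rfl⟩
      exact hall j
    rw [hcP] at hbot
    rw [hbot] at hx₀P
    exact hx₀0 ((Submodule.mem_bot _).mp hx₀P)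
  obtain ⟨i, -, hi0, hmax⟩ := exists_max_valuation O Finset.univ (fun j => ((c j : R) : K)) hne
  have hci : c i ≠ 0 := fun h0 => hi0 (by rw [h0]; rfl)
  -- the local blowing up in the `c i`-chart, and uniqueness
  have h' := isLocalBlowupAlong_of_generators hRO c hcP i hci (fun j => hmax j (Finset.mem_univ j))
  rw [isLocalBlowupAlong_unique h h']
  -- the chart ring `R[P/c_i] ⊆ K` is a regular ring
  obtain ⟨e, x, hd, hx, hxc⟩ := hc.exists_rsop
  have hqr : IsQuasiRegular c := by
    have hq := isQuasiRegular_rsop_comp hd x hx (Fin.castAdd e) (Fin.castAdd_injective _ _)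
    have hcomp : x ∘ Fin.castAdd e = c := funext fun j => hxc j
    rwa [hcomp] at hq
  haveI : IsRegularRing R := isRegularRing_of_isRegularLocalRing R
  haveI : IsRegularRing (R ⧸ Ideal.span (Set.range c)) := by
    rw [hcP]; exact isRegularRing_of_isRegularLocalRing _
  have hB := isRegularRing_blowupChart c i hqr
  have hci' : R.subtype (c i) ≠ 0 := fun h0 => hci (Subtype.ext h0)
  have hreg := isRegularRing_closure_of_isRegularRing_blowupChart R.subtype c i
    Subtype.val_injective hci' hB
  have hset : ((R.subtype.range : Set K) ∪ Set.range fun j => R.subtype (c j) / R.subtype (c i)) =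
      (R : Set K) ∪ (fun y : R => (y : K) / (c i : K)) '' Set.range c := by
    rw [Subring.range_subtype, ← Set.range_comp]
    rfl
  rw [hset] at hreg
  haveI := hreg
  exact isRegularLocalRing_locAtCentre_of_isRegularRing ((le_locAtCentre _ O).trans h'.isLocalBlowup.target_le)

/-! ## G1: regularity along a σ_top-steered run -/

/-- **Every member of a σ_top-steered run from a datum regular at the centre of `O` is a regular local
ring.** Generic in the sub-plan's predicate `Perm` («permissible centre»); only
`Perm S f P → P ≠ ⊤ ∧ IsRegularLocalRing (S ⧸ P)` is consumed (for the sketch's `IsPermissibleCentre`: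
its `IsTopSingComponent` field carries `P.IsPrime`, and `IsRegularLocalRing (R ⧸ P)` is a field). The
run clause is the third conjunct of the sketch's `IsSteeredRunUpTo`, unfolded as in
`steeredRun_dichotomy`. [cite: Abhyankar1959, Lemma 3.20] [cite: Matsumura1987, Thm. 14.2] -/
theorem isRegularLocalRing_of_steeredRunUpTo {k : Type} [Field k] [Algebra k K]
    (Perm : ∀ S : Subring K, IsLocalRing S → S → Ideal S → Prop) (p : ℕ)
    (hPerm : ∀ (S : Subring K) (hS : IsLocalRing S) (f : S) (P : Ideal S),
      Perm S hS f P → P ≠ ⊤ ∧ IsRegularLocalRing (S ⧸ P))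
    (O : ValuationSubring K) (A₀ : Subalgebra k K) (h₀ : A₀.toSubring ≤ O.toSubring)
    (hreg : IsRegularLocalRing (Localization.AtPrime
      (Ideal.comap (Subring.inclusion h₀) (IsLocalRing.maximalIdeal O))))
    (R : ℕ → Subring K) (P : (i : ℕ) → Ideal (R i)) (s : ℕ → K) (N : ℕ)
    (hR0 : R 0 = locAtCentre A₀.toSubring O)
    (hrun : ∀ i < N, ∃ (hL : IsLocalRing (R i)) (hs : s i ^ p ∈ R i),
      (Perm (R i) hL ⟨s i ^ p, hs⟩ (P i) ∨
        (P i = maximalIdeal (R i) ∧ (∀ Q : Ideal (R i), ¬ Perm (R i) hL ⟨s i ^ p, hs⟩ Q) ∧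
          ∃ g : R i, (⟨s i ^ p, hs⟩ : R i) - g ^ p ∈ maximalIdeal (R i) ^ p)) ∧
      IsLocalBlowupAlong O (R i) (P i) (R (i + 1)) ∧
      ∃ x g : K, ((∃ hx : x ∈ R i, (⟨x, hx⟩ : R i) ∈ P i) ∧ x ≠ 0 ∧
        ∀ y : R i, y ∈ P i → O.valuation (y : K) ≤ O.valuation x) ∧ g ∈ R i ∧
        s i = x * s (i + 1) + g) :
    ∀ i ≤ N, IsRegularLocalRing (R i) := by
  intro i
  induction i with
  | zero =>
    intro _
    rw [hR0]
    exact (isRegularLocalRing_locAtCentre_iff h₀).mpr hreg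
  | succ i ih =>
    intro hi
    have hi' : i < N := Nat.lt_of_succ_le hi
    haveI hRi : IsRegularLocalRing (R i) := ih hi'.le
    obtain ⟨hL, hs, hC, hB, -⟩ := hrun i hi'
    rcases hC with hperm | ⟨hPm, -, -⟩
    · obtain ⟨hne, hq⟩ := hPerm _ hL _ _ hperm
      haveI := hq
      exact isRegularLocalRing_of_isLocalBlowupAlong_of_quotient (IsLocalRing.le_maximalIdeal hne) hB
    · have hQT : IsQuadraticTransformAlong O (R i) (R (i + 1)) := ⟨hL, hPm ▸ hB⟩
      exact hQT.isRegularLocalRing_of_isRegularLocalRing hRi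

end SteeredRun

end Summit.ResolutionOfSingularities.ResolutionOfSingularities.Theorems.SwitchingDichotomy
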